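import Summits.ABC.IUTFork.Thm311Real2
import Literature.IUT.LogVolume.PilotTateParameter
import Literature.IUT.HodgeArakelov.GaussianSplittingMonoids
import HarnessLib

/-!
# [IUTchIII] Theorem 3.11 over real definitions, E: the Tate parameters `q_v ∈ K_v` and the embedding of (b) into the tensor packets

Record-only file (D-0012) of the abc-iut cell (Cor. 3.12 sub-crew, wave-2 seat abc-iut-c312-5, board row
W2-A); TAKES NO SIDE on [IUTchIII] Cor. 3.12. In `Thm311Real2` the data (b) of [IUTchIII] Thm. 3.11 (i) — the
splitting monoids `Ψ^⊥_LGP(^{n,∘}HT)_v ⊆ ∏_{j ∈ F_l^⋇} I^ℚ(^{S^±_{j+1},j};D⊢_v)` at `v ∈ V^bad` — is the BINDER `Ψ` of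
`MRData.ofShells`, with the note "their VALUES `q_v^{j²}` need `q_v ∈ K_v` (Tate uniformisation)". For the
Dupuy–Hilado-level instance those values are now REAL:

* `Real.tateParameter X hv : K_v` — THE Tate parameter of `E_F` at a bad place `v ∈ S` of the pilot data: the
  unique `q ∈ F_v` with `q ≠ 0`, `|q|_v < 1`, `j(q) = j_E` (abc-iut-c312-3's `PilotData.exists_tateParameter`,
  `PilotTateParameter.lean`, from the tree's `existsUnique_tateJ_eq_of_one_lt_norm`, Silverman ATAEC V.5.1 —
  Dupuy–Hilado §3.2 "the Tate parameter (a geometric invariant …)"); `tateParameter_spec`;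
* `LogShells.unitEmbed` — for a log-shell signature whose carriers are RINGS (`Real.logShells`: fields `K_v`),
  the map `K_v → I^ℚ(^{S^±_{j+1},j};D⊢_v)`-ambient packet, `x ↦ 1 ⊗ ⋯ ⊗ 1 ⊗ (x at the summand v of the factor j)`
  ([IUTchIII] Prop. 3.4 (ii) p. 102: the splitting monoid acts on / sits in the `j`-labelled sub-packet "the
  direct summand with subscript `v` of the factor labeled `j`" of Prop. 3.1 (ii)/3.2), here for `Real.logShells`;
* `Real.thetaValueTuple X hv n ζ : ∀ j ∈ F_l^⋇, K_v` — the tuples `(ζ_j · q_v^{j²·n})_j` and `Real.splittingValues`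
  — their embedded images `∈ ∏_j Packet j`, a CANDIDATE for the binder `Ψ v hv` pending abc-iut-L6-t2's
  `SplittingMonoidValues` (offered 20:34Z: the exact torsion shape of [IUTchII] Cor. 4.5/4.6's Gaussian monoid
  `Ψ^× · ξ^ℕ` is theirs to state; `splittingValues` takes the torsion family `ζ` as an argument and asserts
  nothing about it beyond `ζ_j^{2l} = 1`).

ERRATUM (review R7-C5-F1, abc-iut-L6-t24, 2026-08-25; docstring-level, the decls of §2 are kept): the printed theta
VALUES are `q̳_v^{j²}` with `q̳_v := q_v^{1/2l}` a `2l`-th ROOT of the Tate parameter ([IUTchI] Ex. 3.2 (iv) p. 71: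
"the value of `Θ_v` at `√−q_v` is equal to `q̳_v := q_v^{1/2l}`"; [IUTchII] Rmk. 2.5.1 (i); Dupuy–Hilado §3.3
`q̲_v = q_v^{1/2l}`, `P_q` with coefficients `ord_v(q_v)/2l` — as in abc-iut-c312-3's `PilotDivisors`). §2's
`thetaValueTuple`/`splittingValues`, built on `q_v` itself, therefore describe the `(2l)`-th POWERS of the printed
values (a coarse envelope only); the exact object is §3's `splittingMonoidLGP`, parametric in a `2l`-th root `qroot`
of `q_v` — an honest ARGUMENT: over arbitrary pilot data such a root need not exist in `F_v` (at the M level it does,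
by [IUTchI] Def. 3.1 (b)(c): `E[2l]` is `K`-rational), and its `μ_{2l}`-ambiguity is Rmk. 2.5.1's torsion
indeterminacy, carried by `ζ`/`μ_{2l}`.
§3 (appended): `Real.splittingMonoidLGP X … v qroot ζ` — the EXACT splitting monoid `μ_{2l}·ξ^ℕ` of the value profile
`ξ = (ζ_j · qroot^{j²})_j` (abc-iut-L6-t2's `gaussianSplittingMonoid`/`valueProfileOf`, p407745) embedded into the
packets, with `valueProfile_pow_twoL` tying it to the Tate parameter when `qroot^{2l} = q_v`.
RESIDUAL: `qroot` (a `2l`-th root of `q_v` in `K_v`) → abc-iut-L5-t2 · IUTchI:Def3.1(b)(c) at the M level (existence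
lemma), binder at the DH level; the identification of `Real.splittingMonoidLGP` with the Kummer image of `Ψ^⊥_{F_LGP}` ([IUTchIII] Prop.
3.5 (ii)(c)) is abc-iut-L6-t4/L6-t2's (interfaces `SplittingMonoids` p403954, `gaussianMonoid` p404298); this file
only supplies the VALUES in the real carriers. [cite: DupuyHilado2025, §3.2] [claim: Mochizuki2012, status: disputed]
typed ≠ discharged; instantiated ≠ endorsed.
-/

noncomputable section

open scoped Classical

namespace Summit.ABC.IUTFork.Thm311.Real

open NumberField IsDedekindDomain Literature.IUT.LogVolume Literature.IUT.LogThetaLattice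
open Literature.NumberTheory.EllipticCurves

variable {F : Type} [Field F] [NumberField F] (X : PilotData F)

/-! ## 1. The Tate parameter at a bad place -/

/-- **The Tate parameter `q_v ∈ K_v`** of `E_F` at a bad place `v ∈ S` of the pilot data: the unique `q ∈ F_v`,
`q ≠ 0`, `|q|_v < 1`, with Tate `j`-invariant `j(q) = j_E` (abc-iut-c312-3's `PilotData.exists_tateParameter`;
Silverman ATAEC Lemma V.5.1; Dupuy–Hilado §3.2). [cite: DupuyHilado2025, §3.2] -/
def tateParameter {v : HeightOneSpectrum (𝓞 F)} (hv : v ∈ X.S) : Carrier (.inr v : Place F) :=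
  (PilotData.exists_tateParameter F X hv).choose

/-- The defining properties of the Tate parameter: `q_v ≠ 0`, `|q_v|_v < 1`, `j(q_v) = j_E`.
[cite: DupuyHilado2025, §3.2] -/
theorem tateParameter_spec {v : HeightOneSpectrum (𝓞 F)} (hv : v ∈ X.S) :
    tateParameter X hv ≠ 0 ∧ ‖(tateParameter X hv : v.adicCompletion F)‖ < 1 ∧
      tateJ (tateParameter X hv : v.adicCompletion F) = (X.jE : v.adicCompletion F) :=
  (PilotData.exists_tateParameter F X hv).choose_spec.1

/-- `q_v ≠ 0`. [cite: DupuyHilado2025, §3.2] -/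
theorem tateParameter_ne_zero {v : HeightOneSpectrum (𝓞 F)} (hv : v ∈ X.S) : tateParameter X hv ≠ 0 :=
  (tateParameter_spec X hv).1

/-- `|q_v|_v < 1`. [cite: DupuyHilado2025, §3.2] -/
theorem norm_tateParameter_lt_one {v : HeightOneSpectrum (𝓞 F)} (hv : v ∈ X.S) :
    ‖(tateParameter X hv : v.adicCompletion F)‖ < 1 :=
  (tateParameter_spec X hv).2.1

/-- Uniqueness: any `q ∈ K_v` with the three properties IS the Tate parameter. [cite: DupuyHilado2025, §3.2] -/
theorem eq_tateParameter {v : HeightOneSpectrum (𝓞 F)} (hv : v ∈ X.S) {q : v.adicCompletion F}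
    (h : q ≠ 0 ∧ ‖q‖ < 1 ∧ tateJ q = (X.jE : v.adicCompletion F)) : q = tateParameter X hv :=
  (PilotData.exists_tateParameter F X hv).choose_spec.2 q h

/-! ## 2. The values `ζ · q_v^{j²n}` and their embedding into the tensor packets -/

variable (logv : PadicLogs F) (Aut Ism : ∀ x : Place F, Set (Carrier x ≃ₗ[ℚ] Carrier x))
  (hAut : ∀ x, LinearEquiv.refl ℚ (Carrier x) ∈ Aut x) (hIsm : ∀ x, LinearEquiv.refl ℚ (Carrier x) ∈ Ism x)

/-- [ERRATUM R7-C5-F1: built on `q_v`; the printed values use a `2l`-th root `q̳_v` — these are their `(2l)`-th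
powers; see §3 `splittingMonoidLGP`.] The tuple `(ζ_j · q_v^{j²·n})_{j ∈ F_l^⋇}` in `K_v` for an exponent `n ∈ ℕ` and a torsion
family `ζ` ([IUTchII] Cor. 4.5/4.6: the Gaussian monoid is generated, up to `2l`-torsion, by the value profile
`(q^{j²})_j`; [IUTchIII] Prop. 3.5 (ii)(c); Dupuy–Hilado §3.3 `P_Θ = (j² P_q)_j`). The torsion family is an
ARGUMENT: which torsion tuples occur is abc-iut-L6-t2's `gaussianMonoid` to say. [claim: Mochizuki2012, status: disputed] -/
def thetaValueTuple {v : HeightOneSpectrum (𝓞 F)} (hv : v ∈ X.S) (n : ℕ)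
    (ζ : (thetaIndex X).LabelStar → Carrier (.inr v : Place F)) :
    (thetaIndex X).LabelStar → Carrier (.inr v : Place F) :=
  fun j => ζ j * tateParameter X hv ^ (((j.1 : ℕ) ^ 2) * n)

/-- The UNIT FAMILY behind the embedding of `K_v` into the `(j+1)`-tensor packet at the summand `v` of the
factor `j`, `x ↦ 1 ⊗ ⋯ ⊗ 1 ⊗ (x·e_v)`: all factors `i ≠ j` carrying the unit `(1, …, 1)` of `⊕_{w | v_ℚ} K_w` and the factor
`j` the vector supported at `v` with value `x` ([IUTchIII] Prop. 3.1 (ii) / 3.2: "the tensor product of the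
factors labeled by `β ∈ A∖{α}` with … the direct summand with subscript `v` of the factor labeled `α`"; Prop.
3.4 (ii) p. 102). For `Real.logShells`, whose carriers are the fields `K_w`. [claim: Mochizuki2012, status: disputed] -/
def unitFamily (j : (thetaIndex X).Label) (v : Place F) (x : Carrier v) :
    (thetaIndex X).Caps j → (logShells X logv Aut Ism hAut hIsm).Packet1 ((thetaIndex X).«over» v) :=
  fun i =>
    if i = (thetaIndex X).selfIndex j then
      Pi.single (M := fun w : (thetaIndex X).Fibre ((thetaIndex X).«over» v) => Carrier w.1)
        ((thetaIndex X).toFibre v) x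
    else fun w => (1 : Carrier w.1)

/-- The `j`-th component of the unit family is the vector `x·e_v` supported at `v`. [folklore] -/
theorem unitFamily_self (j : (thetaIndex X).Label) (v : Place F) (x : Carrier v) :
    unitFamily X logv Aut Ism hAut hIsm j v x ((thetaIndex X).selfIndex j) =
      Pi.single (M := fun w : (thetaIndex X).Fibre ((thetaIndex X).«over» v) => Carrier w.1)
        ((thetaIndex X).toFibre v) x :=
  if_pos rfl

/-- The UNIT EMBEDDING `K_v → log(^{S^±_{j+1}}D⊢_{v_ℚ})`, `x ↦ 1 ⊗ ⋯ ⊗ 1 ⊗ (x·e_v)`: the pure tensor of the unit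
family ([IUTchIII] Prop. 3.4 (ii) p. 102; module docstring). [claim: Mochizuki2012, status: disputed] -/
def unitEmbed (j : (thetaIndex X).Label) (v : Place F) (x : Carrier v) :
    (logShells X logv Aut Ism hAut hIsm).Packet j ((thetaIndex X).«over» v) :=
  (logShells X logv Aut Ism hAut hIsm).tprod j _ (unitFamily X logv Aut Ism hAut hIsm j v x)

/-- The unit embedding lands in abc-iut-c312-1's sub-packet `log(^{S^±_{j+1},j}D⊢_v)` (its `j`-th component is
supported on the summand `v`). [claim: Mochizuki2012, status: disputed] -/
theorem unitEmbed_mem_subPacket (j : (thetaIndex X).Label) (v : Place F) (x : Carrier v) :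
    unitEmbed X logv Aut Ism hAut hIsm j v x ∈ (logShells X logv Aut Ism hAut hIsm).SubPacket j v := by
  refine Submodule.subset_span ⟨unitFamily X logv Aut Ism hAut hIsm j v x, fun w hw => ?_, rfl⟩
  rw [unitFamily_self]
  exact Pi.single_eq_of_ne (M := fun w : (thetaIndex X).Fibre ((thetaIndex X).«over» v) => Carrier w.1)
    (fun h => hw (congrArg Subtype.val h)) _

/-- [ERRATUM R7-C5-F1: coarse envelope built on `q_v`, not on `q̳_v = q_v^{1/2l}`; exact object = §3
`splittingMonoidLGP`.] **The splitting values in the packets**: the family `j ↦ 1 ⊗ ⋯ ⊗ (ζ_j q_v^{j²n} · e_v) ∈ ∏_{j ∈ F_l^⋇}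
I^ℚ(^{S^±_{j+1},j};D⊢_v)` for `n ∈ ℕ` and `2l`-torsion `ζ` — the REAL values a splitting-monoid binder `Ψ v hv`
of `MRData.ofShells` (Thm. 3.11 (i) (b)) ranges over at the Dupuy–Hilado level; the exact torsion pattern of
[IUTchII] Cor. 4.5/4.6 is abc-iut-L6-t2's to fix (module docstring). [claim: Mochizuki2012, status: disputed] -/
def splittingValues {v : HeightOneSpectrum (𝓞 F)} (hv : v ∈ X.S) :
    Set ((logShells X logv Aut Ism hAut hIsm).StarPacket (.inr v : Place F)) :=
  {f | ∃ (n : ℕ) (ζ : (thetaIndex X).LabelStar → Carrier (.inr v : Place F)),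
    (∀ j, ζ j ^ (2 * (thetaIndex X).l) = 1) ∧
      ∀ j, f j = unitEmbed X logv Aut Ism hAut hIsm j.1 (.inr v) (thetaValueTuple X hv n ζ j)}

/-- Every splitting value lies, componentwise, in the sub-packets `log(^{S^±_{j+1},j}D⊢_v)` — the condition
`MRData.PsiInSubPackets` of abc-iut-c312-1's Thm. 3.11 (i) for a `Ψ` ranging in `splittingValues`.
[claim: Mochizuki2012, status: disputed] -/
theorem splittingValues_subPackets {v : HeightOneSpectrum (𝓞 F)} (hv : v ∈ X.S)
    {f : (logShells X logv Aut Ism hAut hIsm).StarPacket (.inr v : Place F)}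
    (hf : f ∈ splittingValues X logv Aut Ism hAut hIsm hv) (j : (thetaIndex X).LabelStar) :
    f j ∈ (logShells X logv Aut Ism hAut hIsm).SubPacket j.1 (.inr v) := by
  obtain ⟨n, ζ, _, hfj⟩ := hf
  rw [hfj j]
  exact unitEmbed_mem_subPacket X logv Aut Ism hAut hIsm j.1 (.inr v) _

/-- NON-VACUITY: the value profile itself (`n = 1`, `ζ = 1`) is a splitting value. [folklore] -/
theorem valueProfile_mem_splittingValues {v : HeightOneSpectrum (𝓞 F)} (hv : v ∈ X.S) :
    ((fun j => unitEmbed X logv Aut Ism hAut hIsm j.1 (.inr v) (thetaValueTuple X hv 1 (fun _ => 1) j)) :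
      (logShells X logv Aut Ism hAut hIsm).StarPacket (.inr v : Place F)) ∈
      splittingValues X logv Aut Ism hAut hIsm hv :=
  ⟨1, fun _ => 1, fun _ => one_pow _, fun _ => rfl⟩

/-! ## 3. The LGP splitting monoid at `v ∈ V^bad`, EXACT shape (abc-iut-L6-t2's `gaussianSplittingMonoid`), on a `2l`-th ROOT of `q_v`

[IUTchI] Ex. 3.2 (iv) p. 71: the theta values are `q̳_v^{j²}`, `q̳_v := q_v^{1/2l}`; [IUTchIII] Prop. 3.5 (ii)(c)
p. 105: "the subgroup of units of `Ψ^⊥` consists of the `2l`-torsion subgroup"; [IUTchII] Cor. 3.5 (ii) / 4.5 /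
4.6: for a value profile `ξ = (ζ_j · q̳_v^{j²})_{j ∈ F_l^⋇}` (torsion `ζ_j` fixed componentwise by the choice of `ξ`,
Rmk. 2.5.1 (iii)) the Gaussian splitting monoid is `μ_{2l} · ξ^ℕ` with ONE root of unity and ONE exponent for all
`j` — abc-iut-L6-t2's `gaussianSplittingMonoid K (2l) ξ ⊆ (F_l^⋇ → K)` with `valueProfileOf qroot (j ↦ j²) ζ`. The
`2l`-th root `qroot` of the Tate parameter is an ARGUMENT (module docstring ERRATUM/RESIDUAL). -/

section LGP

open Literature.IUT.HodgeArakelov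

/-- The embedding of `F_l^⋇`-tuples of elements of `K_v` into `∏_{j ∈ F_l^⋇} log(^{S^±_{j+1}}D⊢_{v_ℚ})`,
componentwise by the unit embeddings `unitEmbed j v`. [claim: Mochizuki2012, status: disputed] -/
def tupleEmbed (v : Place F) (x : (thetaIndex X).LabelStar → Carrier v) :
    (logShells X logv Aut Ism hAut hIsm).StarPacket v :=
  fun j => unitEmbed X logv Aut Ism hAut hIsm j.1 v (x j)

/-- **The LGP splitting monoid at a finite place `v` in the packets, exact shape**: the image under `tupleEmbed` of
abc-iut-L6-t2's Gaussian splitting monoid `μ_{2l} · ξ^ℕ ⊆ (F_l^⋇ → K_v)` of the value profile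
`ξ = (ζ_j · qroot^{j²})_j`, where `qroot ∈ K_v` is to be a `2l`-th root `q̳_v` of the Tate parameter `q_v`
([IUTchI] Ex. 3.2 (iv); an argument here) and `ζ` a chosen componentwise torsion family ([IUTchII] Rmk. 2.5.1
(iii); `ζ ≡ 1` gives `ξ = (q̳_v^{j²})_j`). This is the set the binder `Ψ v hv` of `MRData.ofShells` denotes at the
Dupuy–Hilado level ([IUTchIII] Thm. 3.11 (i) (b); Prop. 3.5 (ii)(c)). [claim: Mochizuki2012, status: disputed] -/
def splittingMonoidLGP (v : HeightOneSpectrum (𝓞 F)) (qroot : Carrier (.inr v : Place F))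
    (ζ : (thetaIndex X).LabelStar → (Carrier (.inr v : Place F))ˣ) :
    Set ((logShells X logv Aut Ism hAut hIsm).StarPacket (.inr v : Place F)) :=
  tupleEmbed X logv Aut Ism hAut hIsm (.inr v) ''
    (gaussianSplittingMonoid (Carrier (.inr v : Place F)) (2 * (thetaIndex X).l)
      (valueProfileOf qroot (fun j : (thetaIndex X).LabelStar => (j.1 : ℕ) ^ 2) ζ) :
        Set ((thetaIndex X).LabelStar → Carrier (.inr v : Place F)))

/-- Every element of the LGP splitting monoid lies componentwise in the sub-packets `log(^{S^±_{j+1},j}D⊢_v)` —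
`MRData.PsiInSubPackets` for `Ψ v hv := splittingMonoidLGP … v qroot ζ`. [claim: Mochizuki2012, status: disputed] -/
theorem splittingMonoidLGP_subPackets (v : HeightOneSpectrum (𝓞 F)) (qroot : Carrier (.inr v : Place F))
    (ζ : (thetaIndex X).LabelStar → (Carrier (.inr v : Place F))ˣ)
    {f : (logShells X logv Aut Ism hAut hIsm).StarPacket (.inr v : Place F)}
    (hf : f ∈ splittingMonoidLGP X logv Aut Ism hAut hIsm v qroot ζ) (j : (thetaIndex X).LabelStar) :
    f j ∈ (logShells X logv Aut Ism hAut hIsm).SubPacket j.1 (.inr v) := by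
  obtain ⟨x, _, rfl⟩ := hf
  exact unitEmbed_mem_subPacket X logv Aut Ism hAut hIsm j.1 (.inr v) (x j)

/-- NON-VACUITY: the embedded value profile `ξ` itself lies in the LGP splitting monoid (`ω = 1`, `n = 1`).
[folklore] -/
theorem valueProfile_mem_splittingMonoidLGP (v : HeightOneSpectrum (𝓞 F)) (qroot : Carrier (.inr v : Place F))
    (ζ : (thetaIndex X).LabelStar → (Carrier (.inr v : Place F))ˣ) :
    tupleEmbed X logv Aut Ism hAut hIsm (.inr v)
        (valueProfileOf qroot (fun j : (thetaIndex X).LabelStar => (j.1 : ℕ) ^ 2) ζ) ∈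
      splittingMonoidLGP X logv Aut Ism hAut hIsm v qroot ζ := by
  refine ⟨_, ?_, rfl⟩
  rw [SetLike.mem_coe, mem_gaussianSplittingMonoid_iff]
  exact ⟨1, one_mem _, 1, by funext i; simp⟩

/-- **Tie to the Tate parameter**: if `qroot^{2l} = q_v` (`qroot = q̳_v`, [IUTchI] Ex. 3.2 (iv)) and the torsion
family is `2l`-torsion, the `(2l)`-th power of the value profile is `(q_v^{j²})_j` — the element-level counterpart of
Dupuy–Hilado's `P_{Θ,j} = j²·P_q` with `P_q`'s coefficients `ord_v(q_v)/2l` (abc-iut-c312-3's `thetaPilot`), via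
abc-iut-L6-t2's `valueProfileOf_pow_twoL`. [cite: DupuyHilado2025, §3.3] -/
theorem valueProfile_pow_twoL {v : HeightOneSpectrum (𝓞 F)} (hv : v ∈ X.S) {qroot : Carrier (.inr v : Place F)}
    (hroot : qroot ^ (2 * (thetaIndex X).l) = tateParameter X hv)
    {ζ : (thetaIndex X).LabelStar → (Carrier (.inr v : Place F))ˣ}
    (hζ : ∀ j, ζ j ∈ rootsOfUnity (2 * (thetaIndex X).l) (Carrier (.inr v : Place F))) :
    valueProfileOf qroot (fun j : (thetaIndex X).LabelStar => (j.1 : ℕ) ^ 2) ζ ^ (2 * (thetaIndex X).l) =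
      fun j : (thetaIndex X).LabelStar => tateParameter X hv ^ ((j.1 : ℕ) ^ 2) := by
  rw [valueProfileOf_pow_twoL qroot _ hζ]
  funext j
  rw [pow_mul, hroot]

end LGP

/-! ## 4. Thm. 3.11 (i) (b)'s placement clause for the real splitting monoids (appended; theorems only)

abc-iut-c312-1's `MRData.PsiInSubPackets` ("(b) places the splitting monoid inside the product of the
SUB-packets `I^ℚ(^{S^±_{j+1},j};D⊢_v)` — part of what an instantiation must check") HOLDS for every
`MRData.ofShells` over the real carriers whose (b)-slot at the bad places is the LGP splitting monoid of §3. -/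

section Placement

variable (archPk : ∀ (j : (thetaIndex X).Label) (vQ : RatPlace), Set ((logShells X logv Aut Ism hAut hIsm).Packet j vQ))
  (archSub : ∀ (j : (thetaIndex X).Label) (v : Place F),
    Set ((logShells X logv Aut Ism hAut hIsm).Packet j ((thetaIndex X).«over» v)))
  (Adm : ∀ (j : (thetaIndex X).Label) (vQ : RatPlace), Set ((logShells X logv Aut Ism hAut hIsm).Packet j vQ) → Prop)
  (logvol : ∀ (j : (thetaIndex X).Label) (vQ : RatPlace), Set ((logShells X logv Aut Ism hAut hIsm).Packet j vQ) → ℝ)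
  (Ψ : ∀ v : Place F, v ∈ (thetaIndex X).Vbad → Set ((logShells X logv Aut Ism hAut hIsm).StarPacket v))
  (act : ∀ v : Place F, v ∈ (thetaIndex X).Vbad → (logShells X logv Aut Ism hAut hIsm).StarPacket v →
    Module.End ℚ ((logShells X logv Aut Ism hAut hIsm).StarPacket v))
  (Mmod : ∀ j : (thetaIndex X).LabelStar, Set ((logShells X logv Aut Ism hAut hIsm).GlobalPacket j.1))

/-- **(b)'s placement clause PROVED for the real instance**: if at every bad place `v` the (b)-slot is the LGP
splitting monoid `splittingMonoidLGP X … v (qroot v) (ζ v)` (any chosen `2l`-th roots and torsion profiles), then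
abc-iut-c312-1's `MRData.PsiInSubPackets` holds for `MRData.ofShells` — every element lies componentwise in
`log(^{S^±_{j+1},j}D⊢_v)` ([IUTchIII] Prop. 3.4 (ii) / Thm. 3.11 (i) (b)). [claim: Mochizuki2012, status: disputed] -/
theorem psiInSubPackets_ofShells_of_LGP
    (qroot : ∀ v : HeightOneSpectrum (𝓞 F), Carrier (.inr v : Place F))
    (ζ : ∀ v : HeightOneSpectrum (𝓞 F), (thetaIndex X).LabelStar → (Carrier (.inr v : Place F))ˣ)
    (hΨ : ∀ (v : HeightOneSpectrum (𝓞 F)) (hv : (.inr v : Place F) ∈ (thetaIndex X).Vbad),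
      Ψ (.inr v) hv = splittingMonoidLGP X logv Aut Ism hAut hIsm v (qroot v) (ζ v)) :
    (MRData.ofShells (logShells X logv Aut Ism hAut hIsm) archPk archSub Adm logvol Ψ act Mmod).PsiInSubPackets := by
  intro v hv x hx j
  rcases v with u | w
  · obtain ⟨v', _, hv'⟩ := (mem_thetaIndex_Vbad_iff X _).mp hv
    exact absurd hv' Sum.inl_ne_inr
  · change x ∈ Ψ (.inr w) hv at hx
    rw [hΨ w hv] at hx
    exact splittingMonoidLGP_subPackets X logv Aut Ism hAut hIsm w (qroot w) (ζ w) hx j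

end Placement

end Summit.ABC.IUTFork.Thm311.Real

end
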